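import Literature.Computability.QuantumComplexity.KeyedOracleBlocks
import Literature.Computability.QuantumComplexity.KeyedOracleFamily
import HarnessLib

/-!
# The keyed-oracle BLOCKS family: several runs on disjoint blocks behind shared Hadamard keys, and its kernel

Topic `Literature/Computability/QuantumComplexity`; sequel of `KeyedOracleFamily.lean` (ONE run of an oracle algorithm
`F` behind Hadamard keys, every query `u` re-targeted to `r ++ key ++ u`: the kernel is the key-average of `F`'s
kernels relative to the slices `A⟨r ++ key⟩`, Zhandry 2012, Thm. 3.1) and `KeyedOracleBlocks.lean` (several circuits
re-targeted to the same prefix on pairwise disjoint blocks: a block event has the key-average of that block's own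
probability; with the block a TRUNCATION of `F.circ n` before an oracle gate and the event "its query register spells a
string of `D`", the block statistic is the key-averaged BBBV query magnitude, Bennett–Bernstein–Brassard–Vazirani
1997, Def. 3.2 / Cor. 3.4). This file packages the construction as a uniform-shape CIRCUIT FAMILY
`KeyedBlocks.family`: on an instance `z` of length `L` it reads `M(L)` input segments `z[b·n, (b+1)·n)` (`n = nOf L`,
one per block — the classical layout writes copies of the algorithm's input there), the parameter wires `z[M·n, L)`,
`M(L)·m` block ancillas and `κ(L)` key wires; its circuit is Hadamards on the key wires followed by the juxtaposition
over `b < M(L)` of the block gate lists `blockGates L b` re-targeted to (parameter ++ key) wires and transported to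
block `b`. Proved:

* layout: `E` (block wires), `pre` (parameter then key wires), `keyT`; `pre_ne_E`, `E_blockDisjoint`;
  `padInput_comp_E` (block `b` of the big basis input is `|z_b 0^m⟩`, `z_b = inpB z b` the `b`-th segment),
  `padInput_keyWires`, `ofFn_prefixContent` (`= z.drop (M·n) ++ key`);
* `sum_normSq_hadamards_flatMap_retarget_block_event'` — the block averaging identity of `KeyedOracleBlocks.lean`
  with block-dependent inputs;
* **`kernelProb_family_eq_avg_probEvent`** — for every oracle `A`, instance `z`, block `b` and event `T` on the
  block register read through `E b`:
  `family.kernelProb A z {s | T (i ↦ s[E b i])} = 2^{-κ} Σ_key probEvent_{A⟨z.drop (M·n) ++ key⟩}(blockGates b on |z_b 0^m⟩, T)`.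

Everything here is PROVED; definitions are explicit (wire maps, the circuit, the family).

## References

* M. Zhandry, *Secure identity-based encryption in the quantum random oracle model*, CRYPTO 2012, Thm. 3.1 [Zhandry2012].
* C. H. Bennett, E. Bernstein, G. Brassard, U. Vazirani, *Strengths and weaknesses of quantum computing*, SIAM J.
  Comput. 26 (1997) 1510–1523, §4, Def. 3.2, Cor. 3.4 [BennettBernsteinBrassardVazirani1997].
* M. A. Nielsen, I. L. Chuang, *Quantum Computation and Quantum Information*, CUP 2010, §2.2.8, §4.3 [NielsenChuang2010].
-/

noncomputable section

namespace Literature.Computability.QuantumComplexity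

open Cryptography Matrix Finset

/-- **Parameters of a keyed blocks run**: the oracle algorithm `F` (its ancilla count is used), the input length
`nOf L`, the number of blocks `MOf L` with `MOf L · nOf L ≤ L`, the number of key wires `κOf L`, and the block gate
lists `blockGates L b` on `nOf L + F.ancillas (nOf L)` wires (e.g. truncations of `F.circ (nOf L)`).
[cite: BennettBernsteinBrassardVazirani1997, §4 (independent subroutine runs)] [cite: Zhandry2012, Thm. 3.1] -/
structure KeyedBlocks where
  /-- The oracle algorithm. -/
  F : QCircuitFamily cliffordT
  /-- The input length of a block on instances of length `L`. -/
  nOf : ℕ → ℕ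
  /-- The number of blocks on instances of length `L`. -/
  MOf : ℕ → ℕ
  /-- The number of key wires on instances of length `L`. -/
  κOf : ℕ → ℕ
  /-- The gate list of block `b` on instances of length `L`. -/
  blockGates : ∀ L : ℕ, Fin (MOf L) → List (QGate cliffordT (nOf L + F.ancillas (nOf L)))
  /-- The input segments fit in the instance. -/
  mul_le : ∀ L, MOf L * nOf L ≤ L

namespace KeyedBlocks

variable (P : KeyedBlocks)

/-- The ancilla count of one block. [cite: Zhandry2012, Thm. 3.1] -/
abbrev mF (L : ℕ) : ℕ := P.F.ancillas (P.nOf L)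

/-- The ancillas of the blocks family: `M` blocks of `m_F`, then the key wires. [cite: Zhandry2012, Thm. 3.1] -/
abbrev anc (L : ℕ) : ℕ := P.MOf L * P.mF L + P.κOf L

/-! ### Index arithmetic -/

/-- `b·n + i < M·n` for `b < M`, `i < n`. [folklore] -/
private theorem mul_add_lt_mul {b M n i : ℕ} (hb : b < M) (hi : i < n) : b * n + i < M * n := by
  have h : (b + 1) * n ≤ M * n := Nat.mul_le_mul_right n hb
  rw [Nat.add_mul, one_mul] at h
  omega

/-- Distinct blocks have distinct positions: `b·n + i ≠ b'·n + i'` for `b ≠ b'`, `i, i' < n`. [folklore] -/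
private theorem mul_add_ne_mul_add {n b b' i i' : ℕ} (hb : b ≠ b') (hi : i < n) (hi' : i' < n) : b * n + i ≠ b' * n + i' := by
  intro h
  rcases Nat.lt_or_gt_of_ne hb with hlt | hlt
  · have h2 : (b + 1) * n ≤ b' * n := Nat.mul_le_mul_right n hlt
    rw [Nat.add_mul, one_mul] at h2
    omega
  · have h2 : (b' + 1) * n ≤ b * n := Nat.mul_le_mul_right n hlt
    rw [Nat.add_mul, one_mul] at h2
    omega

/-! ### Wire maps -/

/-- **The wires of block `b`**: input wire `i < n` ↦ `b·n + i` (the `b`-th input segment of the instance), ancilla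
wire `n + j` ↦ `L + b·m + j`. [cite: NielsenChuang2010, §4.3 (placing a gate on chosen wires)] -/
def E (L : ℕ) (b : Fin (P.MOf L)) : Fin (P.nOf L + P.mF L) ↪ Fin (L + P.anc L) where
  toFun i := ⟨if (i : ℕ) < P.nOf L then (b : ℕ) * P.nOf L + (i : ℕ) else L + (b : ℕ) * P.mF L + ((i : ℕ) - P.nOf L), by
    have hi := i.2; have hb := b.2; have := P.mul_le L
    show _ < L + (P.MOf L * P.mF L + P.κOf L)
    split_ifs with h
    · have := mul_add_lt_mul hb h; omega
    · have := mul_add_lt_mul (n := P.mF L) hb (i := (i : ℕ) - P.nOf L) (by omega); omega⟩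
  inj' i j h := by
    have hi := i.2; have hj := j.2
    simp only [Fin.mk.injEq] at h
    apply Fin.ext
    split_ifs at h with h1 h2 h2
    · omega
    · have := mul_add_lt_mul b.2 h1; have := P.mul_le L; omega
    · have := mul_add_lt_mul b.2 h2; have := P.mul_le L; omega
    · omega

/-- Value of `E`. [cite: NielsenChuang2010, §4.3] -/
theorem E_val (L : ℕ) (b : Fin (P.MOf L)) (i : Fin (P.nOf L + P.mF L)) :
    ((P.E L b i : Fin (L + P.anc L)) : ℕ) =
      if (i : ℕ) < P.nOf L then (b : ℕ) * P.nOf L + (i : ℕ) else L + (b : ℕ) * P.mF L + ((i : ℕ) - P.nOf L) := rfl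

/-- **The prefix wires**: parameter wire `a < L − M·n` ↦ `M·n + a`, key wire `j` ↦ `L + M·m + j`.
[cite: Zhandry2012, Thm. 3.1 (the key)] [cite: NielsenChuang2010, §4.3] -/
def pre (L : ℕ) : Fin ((L - P.MOf L * P.nOf L) + P.κOf L) ↪ Fin (L + P.anc L) where
  toFun a := ⟨if (a : ℕ) < L - P.MOf L * P.nOf L then P.MOf L * P.nOf L + (a : ℕ)
      else L + P.MOf L * P.mF L + ((a : ℕ) - (L - P.MOf L * P.nOf L)), by
    have := a.2; have := P.mul_le L; show _ < L + (P.MOf L * P.mF L + P.κOf L); split_ifs <;> omega⟩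
  inj' a b h := by
    have ha := a.2; have hb := b.2; have := P.mul_le L
    simp only [Fin.mk.injEq] at h
    apply Fin.ext
    split_ifs at h <;> omega

/-- Value of `pre`. [cite: NielsenChuang2010, §4.3] -/
theorem pre_val (L : ℕ) (a : Fin ((L - P.MOf L * P.nOf L) + P.κOf L)) :
    ((P.pre L a : Fin (L + P.anc L)) : ℕ) =
      if (a : ℕ) < L - P.MOf L * P.nOf L then P.MOf L * P.nOf L + (a : ℕ)
      else L + P.MOf L * P.mF L + ((a : ℕ) - (L - P.MOf L * P.nOf L)) := rfl

/-- **The key wires among the prefix wires** (the last `κ`). [cite: Zhandry2012, Thm. 3.1] -/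
def keyT (L : ℕ) : Fin (P.κOf L) ↪ Fin ((L - P.MOf L * P.nOf L) + P.κOf L) where
  toFun j := Fin.natAdd (L - P.MOf L * P.nOf L) j
  inj' i j h := by simpa using h

/-- Value of a key wire in the big register: `L + M·m + j`. [cite: NielsenChuang2010, §4.3] -/
theorem keyT_trans_pre_val (L : ℕ) (j : Fin (P.κOf L)) :
    ((((P.keyT L).trans (P.pre L)) j : Fin (L + P.anc L)) : ℕ) = L + P.MOf L * P.mF L + (j : ℕ) := by
  rw [Function.Embedding.trans_apply, pre_val]
  simp only [keyT, Function.Embedding.coeFn_mk, Fin.natAdd]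
  rw [if_neg (by omega)]
  simp

/-- The prefix wires and the block wires are disjoint. [cite: NielsenChuang2010, §4.3] -/
theorem pre_ne_E (L : ℕ) : ∀ b a i, P.pre L a ≠ P.E L b i := by
  intro b a i h
  have hv := congrArg Fin.val h
  rw [pre_val, E_val] at hv
  have := a.2; have hi := i.2; have hb := b.2; have := P.mul_le L
  split_ifs at hv with h1 h2 h2
  · have := mul_add_lt_mul hb h2; omega
  · omega
  · have := mul_add_lt_mul hb h2; omega
  · have := mul_add_lt_mul (n := P.mF L) hb (i := (i : ℕ) - P.nOf L) (by omega); omega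

/-- **The blocks are pairwise disjoint.** [cite: NielsenChuang2010, §4.3] -/
theorem E_blockDisjoint (L : ℕ) : BlockDisjoint (P.E L) := by
  intro b b' hbb'
  rw [Set.disjoint_iff]
  rintro w ⟨⟨i, hi⟩, ⟨i', hi'⟩⟩
  have hv : ((P.E L b i : Fin _) : ℕ) = ((P.E L b' i' : Fin _) : ℕ) := by rw [hi, hi']
  rw [E_val, E_val] at hv
  have hbn : (b : ℕ) ≠ (b' : ℕ) := fun h => hbb' (Fin.ext h)
  have h1 := i.2; have h2 := i'.2; have := P.mul_le L
  split_ifs at hv with c1 c2 c2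
  · exact mul_add_ne_mul_add hbn c1 c2 hv
  · have := mul_add_lt_mul b.2 c1; omega
  · have := mul_add_lt_mul b'.2 c2; omega
  · have h3 : (b : ℕ) * P.mF L + ((i : ℕ) - P.nOf L) = (b' : ℕ) * P.mF L + ((i' : ℕ) - P.nOf L) := by omega
    exact mul_add_ne_mul_add hbn (by omega) (by omega) h3

/-! ### The family -/

/-- **The keyed blocks circuit on instances of length `L`**: Hadamards on the key wires, then for each block `b < M(L)`
the block gate list re-targeted to the prefix (parameter wires, then key wires) and transported to block `b`.
[cite: Zhandry2012, Thm. 3.1] [cite: BennettBernsteinBrassardVazirani1997, §4] -/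
def circ (L : ℕ) : QCircuit cliffordT (L + P.anc L) :=
  ⟨(List.ofFn ((P.keyT L).trans (P.pre L))).map hOn ++
    (List.finRange (P.MOf L)).flatMap fun b => retarget (P.pre L) (P.E L b) (P.pre_ne_E L b) (P.blockGates L b)⟩

/-- **The keyed blocks family.** [cite: Zhandry2012, Thm. 3.1] [cite: BennettBernsteinBrassardVazirani1997, §4] -/
def family : QCircuitFamily cliffordT where
  ancillas := P.anc
  circ := P.circ

/-! ### The input segments and the prefix content -/

/-- **The input register of block `b`**: the segment `z[b·n, (b+1)·n)` of the instance. [cite: Zhandry2012, Thm. 3.1] -/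
def inpB (z : List Bool) (b : Fin (P.MOf z.length)) : QReg (P.nOf z.length) :=
  fun i => z.get ⟨(b : ℕ) * P.nOf z.length + (i : ℕ),
    lt_of_lt_of_le (mul_add_lt_mul b.2 i.2) (P.mul_le z.length)⟩

/-- Values of a padded input. [folklore] -/
private theorem padInput_val {n M : ℕ} (x : QReg n) (i : Fin (n + M)) :
    padInput x M i = if h : (i : ℕ) < n then x ⟨i, h⟩ else false := by
  unfold padInput
  by_cases h : (i : ℕ) < n
  · rw [dif_pos h]
    have : i = Fin.castAdd M ⟨i, h⟩ := Fin.ext rfl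
    conv_lhs => rw [this]
    exact Fin.append_left _ _ _
  · rw [dif_neg h]
    obtain ⟨j, rfl⟩ : ∃ j : Fin M, i = Fin.natAdd n j := ⟨⟨(i : ℕ) - n, by omega⟩, Fin.ext (by simp; omega)⟩
    exact Fin.append_right _ _ _

/-- **Block `b` of the big basis input is `|z_b 0^{m_F}⟩`.** [cite: NielsenChuang2010, §4.3] -/
theorem padInput_comp_E (z : List Bool) (b : Fin (P.MOf z.length)) :
    padInput z.get (P.anc z.length) ∘ P.E z.length b = padInput (P.inpB z b) (P.mF z.length) := by
  funext i
  simp only [Function.comp_apply]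
  rw [padInput_val, padInput_val]
  by_cases hi : (i : ℕ) < P.nOf z.length
  · have hlt : ((P.E z.length b i : Fin (z.length + P.anc z.length)) : ℕ) < z.length := by
      rw [E_val, if_pos hi]; exact lt_of_lt_of_le (mul_add_lt_mul b.2 hi) (P.mul_le z.length)
    rw [dif_pos hlt, dif_pos hi]
    simp only [inpB, List.get_eq_getElem]
    congr 1
    rw [E_val, if_pos hi]
  · have hge : ¬ ((P.E z.length b i : Fin (z.length + P.anc z.length)) : ℕ) < z.length := by
      rw [E_val, if_neg hi]; omega
    rw [dif_neg hge, dif_neg hi]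

/-- The big basis input reads `0` on all the key wires (stated for the whole key register). [cite: NielsenChuang2010, §1.4.4] -/
theorem padInput_keyWires (z : List Bool) :
    ∀ j : Fin (P.κOf z.length), padInput z.get (P.anc z.length) (((P.keyT z.length).trans (P.pre z.length)) j) = false :=
  fun j => by
    rw [padInput_val, dif_neg]
    rw [keyT_trans_pre_val]
    omega

/-- The list of the entries of `z` from position `k ≤ |z|` on is `z.drop k`. [folklore] -/
private theorem ofFn_get_add_eq_drop (z : List Bool) {k : ℕ} (hk : k ≤ z.length) :
    (List.ofFn fun a : Fin (z.length - k) => z.get ⟨k + (a : ℕ), by omega⟩) = z.drop k := by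
  apply List.ext_getElem
  · simp
  · intro i h1 h2
    simp [List.getElem_drop]

/-- A parameter wire is not a key wire. [cite: NielsenChuang2010, §4.3] -/
theorem pre_castLE_not_mem_range (L : ℕ) (a : Fin (L - P.MOf L * P.nOf L)) :
    (P.pre L) (Fin.castLE (Nat.le_add_right _ _) a) ∉ Set.range ((P.keyT L).trans (P.pre L)) := by
  rintro ⟨j, hj⟩
  have hv := congrArg Fin.val hj
  rw [keyT_trans_pre_val, pre_val] at hv
  have := a.2; have := P.mul_le L
  simp only [Fin.val_castLE] at hv
  split_ifs at hv
  all_goals omega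

/-- **The prefix content on the branch of `key`** is `z.drop (M·n) ++ key`. [cite: Zhandry2012, Thm. 3.1]
[cite: NielsenChuang2010, §4.4] -/
theorem ofFn_prefixContent (z : List Bool) (key : QReg (P.κOf z.length)) :
    List.ofFn (assignKey ((P.keyT z.length).trans (P.pre z.length)) (padInput z.get (P.anc z.length)) key ∘
      P.pre z.length) = z.drop (P.MOf z.length * P.nOf z.length) ++ List.ofFn key := by
  rw [List.ofFn_add, ← ofFn_get_add_eq_drop z (P.mul_le z.length)]
  congr 1
  · apply List.ofFn_inj.2
    funext a
    simp only [Function.comp_apply]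
    rw [assignKey_of_not_mem_range _ _ _ (P.pre_castLE_not_mem_range z.length a), padInput_val]
    have hlt : ((P.pre z.length (Fin.castLE (Nat.le_add_right _ _) a) : Fin (z.length + P.anc z.length)) : ℕ) <
        z.length := by
      rw [pre_val]; simp only [Fin.val_castLE]; rw [if_pos a.2]; have := a.2; omega
    rw [dif_pos hlt]
    simp only [List.get_eq_getElem]
    congr 1
    rw [pre_val]; simp only [Fin.val_castLE]; rw [if_pos a.2]
  · apply List.ofFn_inj.2
    funext j
    simp only [Function.comp_apply]
    have h := congrFun (assignKey_comp ((P.keyT z.length).trans (P.pre z.length))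
      (padInput z.get (P.anc z.length)) key) j
    simp only [Function.comp_apply, Function.Embedding.trans_apply] at h
    exact h

end KeyedBlocks

/-! ### The block averaging identity with block-dependent inputs -/

/-- **Key-averaged block events, block-dependent inputs** (`KeyedOracleBlocks.sum_normSq_hadamards_flatMap_retarget_block_event`
with `w ∘ E b = x_b 0^m`). [cite: Zhandry2012, Thm. 3.1] [cite: NielsenChuang2010, §2.2.8] -/
theorem sum_normSq_hadamards_flatMap_retarget_block_event' {n m N P κ M : ℕ}
    (pre : Fin M → List (QGate cliffordT (n + m)))
    (p : Fin P ↪ Fin N) (E : Fin M → (Fin (n + m) ↪ Fin N)) (hdisj : ∀ b a i, p a ≠ E b i) (hE : BlockDisjoint E)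
    (t : Fin κ ↪ Fin P) (A : Language Bool) (w : QReg N) (x : Fin M → QReg n) (hwx : ∀ b, w ∘ E b = padInput (x b) m)
    (hw0 : ∀ j, w ((t.trans p) j) = false) (b : Fin M) (T : QReg (n + m) → Prop) [DecidablePred T] :
    (∑ y ∈ univ.filter (fun y : QReg N => T (y ∘ E b)),
        ‖((⟨(List.ofFn (t.trans p)).map hOn ++
            (List.finRange M).flatMap fun b => retarget p (E b) (hdisj b) (pre b)⟩ : QCircuit cliffordT N).toMatrix A *ᵥ
          basisState w) y‖ ^ 2) =
      (1 / 2 : ℝ) ^ κ * ∑ key : QReg κ, ∑ u : QReg (n + m),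
        if T u then ‖(⟨pre b⟩ : QCircuit cliffordT (n + m)).toMatrix
          (prefixSlice A (List.ofFn (assignKey (t.trans p) w key ∘ p))) u (padInput (x b) m)‖ ^ 2 else 0 := by
  classical
  have hbody : KeyDiagonal (t.trans p)
      ((⟨(List.finRange M).flatMap fun b => retarget p (E b) (hdisj b) (pre b)⟩ : QCircuit cliffordT N).toMatrix A) :=
    (keyDiagonal_flatMap_retarget p E hdisj A pre (List.finRange M)).of_trans t
  rw [sum_normSq_hadamards_then_keyDiagonal (t.trans p) _ A hbody w hw0]
  congr 1
  refine Finset.sum_congr rfl fun key _ => ?_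
  rw [Finset.sum_filter,
    sum_normSq_flatMap_retarget_block_event p E hdisj cliffordT_isUnitary_holds A hE pre (assignKey (t.trans p) w key) b T,
    assignKey_comp_emb p (E b) (hdisj b) t w key, hwx b]
  refine Finset.sum_congr rfl fun u _ => ?_
  rw [mulVec_basisState]

namespace KeyedBlocks

variable (P : KeyedBlocks)

/-- Reading a position of `List.ofFn y` inside the range. [folklore] -/
private theorem getD_ofFn' {W : ℕ} (y : QReg W) (i : Fin W) : (List.ofFn y).getD (i : ℕ) false = y i := by
  rw [List.getD_eq_getElem?_getD, List.getElem?_ofFn, dif_pos i.2, Option.getD_some]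

/-- **The key-average identity for the keyed blocks family (all-wires kernel, an event on one block).** For every
oracle `A`, instance `z` (`n = nOf |z|`, `M = MOf |z|`, parameter `z.drop (M·n)`), block `b` and event `T` on the block
register read through `E b`: the probability that the measured string `s` satisfies `T (i ↦ s[E b i])` is
`2^{-κ} Σ_key probEvent_{A⟨z.drop (M·n) ++ key⟩}(blockGates b run on |z_b 0^{m_F}⟩, {u | T u})`.
[cite: Zhandry2012, Thm. 3.1] [cite: BennettBernsteinBrassardVazirani1997, §4] [cite: NielsenChuang2010, §2.2.8] -/
theorem kernelProb_family_eq_avg_probEvent (A : Language Bool) (z : List Bool) (b : Fin (P.MOf z.length))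
    (T : QReg (P.nOf z.length + P.mF z.length) → Prop) [DecidablePred T] :
    P.family.kernelProb A z {s | T fun i => s.getD ((P.E z.length b i : Fin (z.length + P.anc z.length)) : ℕ) false} =
      (1 / 2 : ℝ) ^ P.κOf z.length * ∑ key : QReg (P.κOf z.length),
        (⟨P.blockGates z.length b⟩ : QCircuit cliffordT (P.nOf z.length + P.mF z.length)).probEvent
          (prefixSlice A (z.drop (P.MOf z.length * P.nOf z.length) ++ List.ofFn key))
          (basisState (padInput (P.inpB z b) (P.mF z.length))) {u | T u} := by
  classical
  have hk : P.family.kernelProb A z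
      {s | T fun i => s.getD ((P.E z.length b i : Fin (z.length + P.anc z.length)) : ℕ) false} =
      ∑ y : QReg (z.length + P.anc z.length),
        if List.ofFn y ∈ {s : List Bool | T fun i => s.getD ((P.E z.length b i : Fin (z.length + P.anc z.length)) : ℕ) false}
        then ‖(P.circ z.length).runOn A (basisState (padInput z.get (P.anc z.length))) y‖ ^ 2 else 0 :=
    toReal_outputPMF_map_ofFn (P.circ z.length) z.get _
  rw [hk]
  have hev : ∀ y : QReg (z.length + P.anc z.length),
      (List.ofFn y ∈ {s : List Bool | T fun i => s.getD ((P.E z.length b i : Fin (z.length + P.anc z.length)) : ℕ) false}) ↔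
        T (y ∘ P.E z.length b) := by
    intro y
    simp only [Set.mem_setOf_eq, getD_ofFn', Function.comp_def]
  simp_rw [hev]
  rw [← Finset.sum_filter]
  have hmain := sum_normSq_hadamards_flatMap_retarget_block_event' (P.blockGates z.length) (P.pre z.length)
    (P.E z.length) (P.pre_ne_E z.length) (P.E_blockDisjoint z.length) (P.keyT z.length) A
    (padInput z.get (P.anc z.length)) (P.inpB z) (P.padInput_comp_E z) (P.padInput_keyWires z) b T
  rw [← circ] at hmain
  unfold QCircuit.runOn
  rw [hmain]
  congr 1
  refine Finset.sum_congr rfl fun key _ => ?_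
  rw [ofFn_prefixContent, sum_ite_normSq_toMatrix_eq_probEvent]

end KeyedBlocks

end Literature.Computability.QuantumComplexity

end
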